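import Literature.IUT.LogVolume.Corollary23JInv
import Literature.NumberTheory.DiophantineGeometry.GenEllTwoStrength
import HarnessLib

/-!
# [IUTchIV] Cor. 2.2 ⟹ abc for balanced, `2`-tame triples — WITHOUT [GenEll] Thm. 2.1

Mochizuki, *Inter-universal Teichmüller theory IV*, RIMS manuscript (Apr. 2020; = PRIMS **57**
(2021)), Cor. 2.2 p. 41 / Cor. 2.3 pp. 54–55 [claim: Mochizuki2012, status: disputed]. Proof-only
(no definitions, no facts). TAKES NO SIDE: `Cor22.Corollary22 H_unif` (typed in
`Corollary22Statement.lean`; its printed proof applies Thm. 1.10, which rests on [IUTchIII]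
Cor. 3.12) enters as a HYPOTHESIS, never asserted.

The campaign-S chain of record is `Corollary22 H ⟹ (JInvVacuous, PROVED) ⟹ ABCCompactlyBounded {2}
⟹ ([GenEll] Thm. 2.1 (ii)⟹(i), the named classical fact / route item GenEllTwo) ⟹ abc`. This file
records what the chain yields WITHOUT the [GenEll] input: by `GenEllTwoStrength`
(`log_le_of_abcCompactlyBounded_two`), typed Cor. 2.2 alone already gives the abc inequality
`log c ≤ (1+ε)·log rad(abc) + C` (resp. `c < C·rad(abc)^{1+ε}`) uniformly on the abc triples that are
`ρ`-balanced (`a, b > ρ·c`) and `2`-tame (`2^{v₂(a)}, 2^{v₂(b)}, 2^{v₂(c)} ≤ ρ⁻¹`), `0 < ρ ≤ 1/2` — the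
triples whose point `a/c` lies in a compactly bounded subset with support `{∞, 2}`, exactly the locus
[IUTchIV] Cor. 2.2 (ii) speaks about; [GenEll] Thm. 2.1 is needed only to pass from this locus to ALL
triples. Kernel bookkeeping; nothing is asserted unconditionally.
-/

noncomputable section

namespace Literature.IUT.LogVolume

namespace Cor22

open Literature.NumberTheory.DiophantineGeometry Literature.NumberTheory.DiophantineGeometry.GenEll

/-- **Typed [IUTchIV] Cor. 2.2 ⟹ abc on balanced `2`-tame triples (logarithmic form), without
[GenEll] Thm. 2.1**: `Corollary22 H_unif` and the PROVED vacuity input `jInvVacuous_holds` give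
`ABCCompactlyBounded {2}` (`abcCompactlyBounded_two_of_corollary22`), whence the inequality on the
annulus locus (`GenEll.log_le_of_abcCompactlyBounded_two`). [claim: Mochizuki2012, status: disputed] -/
theorem log_le_tame_of_corollary22 {Hunif : ℝ} (h22 : Corollary22 Hunif) {ρ : ℝ} (h0 : 0 < ρ)
    (h2 : ρ ≤ 1 / 2) {ε : ℝ} (hε : 0 < ε) :
    ∃ C : ℝ, ∀ a b c : ℕ, IsABCTriple a b c → ρ * c < a → ρ * c < b →
      (2 : ℝ) ^ padicValNat 2 a ≤ ρ⁻¹ → (2 : ℝ) ^ padicValNat 2 b ≤ ρ⁻¹ →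
      (2 : ℝ) ^ padicValNat 2 c ≤ ρ⁻¹ →
      Real.log c ≤ (1 + ε) * Real.log (rad a b c) + C :=
  log_le_of_abcCompactlyBounded_two (abcCompactlyBounded_two_of_corollary22 h22 jInvVacuous_holds)
    h0 h2 hε

/-- **Typed [IUTchIV] Cor. 2.2 ⟹ abc on balanced `2`-tame triples (the summit's multiplicative form
`c < C·rad(abc)^{1+ε}` on that family), without [GenEll] Thm. 2.1.** [claim: Mochizuki2012, status: disputed] -/
theorem abc_tame_of_corollary22 {Hunif : ℝ} (h22 : Corollary22 Hunif) {ρ : ℝ} (h0 : 0 < ρ)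
    (h2 : ρ ≤ 1 / 2) {ε : ℝ} (hε : 0 < ε) :
    ∃ C : ℝ, 0 < C ∧ ∀ a b c : ℕ, IsABCTriple a b c → ρ * c < a → ρ * c < b →
      (2 : ℝ) ^ padicValNat 2 a ≤ ρ⁻¹ → (2 : ℝ) ^ padicValNat 2 b ≤ ρ⁻¹ →
      (2 : ℝ) ^ padicValNat 2 c ≤ ρ⁻¹ →
      (c : ℝ) < C * ((rad a b c : ℕ) : ℝ) ^ (1 + ε) :=
  abc_tame_of_abcCompactlyBounded_two (abcCompactlyBounded_two_of_corollary22 h22 jInvVacuous_holds)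
    h0 h2 hε

/-- **Typed [IUTchIV] Cor. 2.2 along the explicit infinite family `(4m+1, 4m+2, 8m+3)`**, without
[GenEll] Thm. 2.1: `log(8m+3) ≤ (1+ε)·log rad((4m+1)(4m+2)(8m+3)) + C(ε)` for all `m`.
[claim: Mochizuki2012, status: disputed] -/
theorem log_le_family_of_corollary22 {Hunif : ℝ} (h22 : Corollary22 Hunif) {ε : ℝ} (hε : 0 < ε) :
    ∃ C : ℝ, ∀ m : ℕ, Real.log ((8 * m + 3 : ℕ) : ℝ) ≤
      (1 + ε) * Real.log (rad (4 * m + 1) (4 * m + 2) (8 * m + 3)) + C :=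
  log_le_family_of_abcCompactlyBounded_two
    (abcCompactlyBounded_two_of_corollary22 h22 jInvVacuous_holds) hε

end Cor22

end Literature.IUT.LogVolume

end
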